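import Literature.Topology.FourManifolds.HCobordismTwoLeaves
import Literature.Topology.FourManifolds.HomotopySpheresHCobordismProofs
import Literature.Topology.FourManifolds.HCobordismWhitneyIsotopyProofs
import HarnessLib

/-!
# The smooth h-cobordism theorem (Milnor 1965, Thms. 7.8, 9.1, 9.2) and the Kervaire–Milnor
# Remark from the ONE leaf of Milnor's proof DAG that is still a named fact

Topic `Literature/Topology/FourManifolds` (fact-decompose record, 2026-08-16, for the capped named
fact `Literature.Topology.FourManifolds.Milnor1965_exists_isMorseFunction_forall_not_isMCriticalPt`,
Milnor's Thm. 7.8). Sibling of `HCobordismTwoLeaves.lean` and `HomotopySpheresHCobordismProofs.lean`,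
which close Thm. 7.8 (F78), Thm. 9.1 (`isTrivial_of_isHCobordism_of_five_le`), Thm. 9.2
(`nonempty_diffeomorph_of_isHCobordant_of_five_le`) and the Kervaire–Milnor Remark
(`HomotopySphere.isHCobordant_iff_nonempty_diffeomorph_of_five_le`, Ann. of Math. 77 (1963),
p. 505) modulo the two leaves B (Basis Theorem 7.6 on a slab,
`Literature.Topology.FourManifolds.Cobordism.Milnor1965_basisTheorem_slab`) and W (Thm. 6.6 with its
Remark, `Literature.Topology.FourManifolds.Milnor1965_whitney_isotopy`). Leaf W has since become a
THEOREM of the tree (`Literature.Topology.FourManifolds.Milnor1965_whitney_isotopy_holds`,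
`HCobordismWhitneyIsotopyProofs.lean`: Lemmas 6.7–6.13 in sheet form), so each statement is now
closed modulo exactly B — the decomposition of the capped fact is *parent ⇐ one existing named
fact*, and nothing new needs to be vendored:

| statement | Milnor 1965 | from B alone |
|---|---|---|
| F78 | Thm. 7.8 (PDF p. 53) | `Milnor1965_exists_isMorseFunction_forall_not_isMCriticalPt_holds_of` |
| Thm. 9.1 | PDF p. 57 | `isTrivial_of_isHCobordism_of_five_le_holds_of` |
| Thm. 9.2 | PDF p. 57 | `nonempty_diffeomorph_of_isHCobordant_of_five_le_holds_of` |
| KM Remark | KM 1963 p. 505 | `HomotopySphere.isHCobordant_iff_nonempty_diffeomorph_of_five_le_holds_of` |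

The discharges `…_holds` are these theorems applied to
`Cobordism.Milnor1965_basisTheorem_slab_holds` once it lands (its own frontier is the one-slide
step of the proof of Thm. 7.6, `Cobordism.Milnor1965_basisTheorem_slab_of_slideStep`,
`HCobordismBasisInduction.lean`). Everything here is proved; no definitions, no named facts.

## References

* J. Milnor, *Lectures on the h-cobordism theorem*, notes by L. Siebenmann and J. Sondow,
  Princeton Mathematical Notes (1965): Thm. 7.8 (PDF p. 53), Thms. 9.1, 9.2 (PDF p. 57),
  Thm. 7.6 (PDF pp. 49–50), Thm. 6.6 and Remark (PDF pp. 38–39). [MilnorHCobordism1965]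
* M. A. Kervaire, J. W. Milnor, *Groups of homotopy spheres: I*, Ann. of Math. (2) 77 (1963),
  504–537, p. 505 (Remark). [KervaireMilnorAnnals1963]
-/

open scoped Manifold ContDiff Topology

noncomputable section

namespace Literature.Topology.FourManifolds

universe u

/-- **Milnor 1965, Thm. 7.8 (F78) from the Basis Theorem 7.6 on a slab alone**: the capped named
fact `Milnor1965_exists_isMorseFunction_forall_not_isMCriticalPt` follows from
`Cobordism.Milnor1965_basisTheorem_slab` (leaf B), Thm. 6.6 being the theorem
`Milnor1965_whitney_isotopy_holds` and Cor. 7.3 on a slab the theorem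
`Cobordism.Milnor1965_intersectionNumber_slab_holds`
(`Milnor1965_exists_isMorseFunction_forall_not_isMCriticalPt_of_two_leaves`).
[cite: MilnorHCobordism1965, Thm. 7.8 and its proof (PDF p. 53), Thm. 7.6 (PDF pp. 49–50), Thm. 6.6 and Remark (PDF pp. 38–39)] -/
theorem Milnor1965_exists_isMorseFunction_forall_not_isMCriticalPt_holds_of
    (hB : Cobordism.Milnor1965_basisTheorem_slab.{u}) :
    Milnor1965_exists_isMorseFunction_forall_not_isMCriticalPt.{u} :=
  Milnor1965_exists_isMorseFunction_forall_not_isMCriticalPt_of_two_leaves hB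
    Milnor1965_whitney_isotopy_holds

/-- **The h-cobordism theorem (Milnor 1965, Thm. 9.1) from leaf B alone**
(`isTrivial_of_isHCobordism_of_five_le_of_two_leaves` with `Milnor1965_whitney_isotopy_holds`).
[cite: MilnorHCobordism1965, Thm. 9.1 and its proof (PDF p. 57), Thm. 7.6 (PDF pp. 49–50)] -/
theorem isTrivial_of_isHCobordism_of_five_le_holds_of
    (hB : Cobordism.Milnor1965_basisTheorem_slab.{u}) :
    isTrivial_of_isHCobordism_of_five_le.{u} :=
  isTrivial_of_isHCobordism_of_five_le_of_two_leaves hB Milnor1965_whitney_isotopy_holds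

/-- **Milnor 1965, Thm. 9.2 from leaf B alone**
(`nonempty_diffeomorph_of_isHCobordant_of_five_le_of_two_leaves` with
`Milnor1965_whitney_isotopy_holds`).
[cite: MilnorHCobordism1965, Thm. 9.2 (PDF p. 57), Thm. 7.6 (PDF pp. 49–50)] -/
theorem nonempty_diffeomorph_of_isHCobordant_of_five_le_holds_of
    (hB : Cobordism.Milnor1965_basisTheorem_slab.{u}) :
    nonempty_diffeomorph_of_isHCobordant_of_five_le.{u} :=
  nonempty_diffeomorph_of_isHCobordant_of_five_le_of_two_leaves hB Milnor1965_whitney_isotopy_holds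

namespace HomotopySphere

variable {n : ℕ}

/-- **Kervaire–Milnor 1963, p. 505 (Remark: homotopy `n`-spheres, `n ≥ 5`, are h-cobordant iff
diffeomorphic) from leaf B alone** (`isHCobordant_iff_nonempty_diffeomorph_of_five_le_of_two_leaves`
with `Milnor1965_whitney_isotopy_holds`, universe `0`).
[cite: KervaireMilnorAnnals1963, p. 505 (Remark, from Smale [26])] [cite: MilnorHCobordism1965, Thm. 7.6 (PDF p. 50), proof of Thm. 9.1 (PDF p. 57)] -/
theorem isHCobordant_iff_nonempty_diffeomorph_of_five_le_holds_of
    (hB : Cobordism.Milnor1965_basisTheorem_slab.{0}) :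
    isHCobordant_iff_nonempty_diffeomorph_of_five_le (n := n) :=
  isHCobordant_iff_nonempty_diffeomorph_of_five_le_of_two_leaves hB
    FourManifolds.Milnor1965_whitney_isotopy_holds

end HomotopySphere

end Literature.Topology.FourManifolds

end
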